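import Summits.BirchSwinnertonDyer.Rank1Residual.X11b.LevelLiftingFromFiniteness
import Summits.BirchSwinnertonDyer.BirchSwinnertonDyer.Theorems.PrintCf2SplitBadTwoRestrictedSelmerEigenProjector
import HarnessLib

/-!
# Crux `PrintCf2.SplitBadTwoRankOneOfFacts` (stmt-BirchSwinnertonDyer-20368), road α v10.3, S3c residual (R-TOP) = brick B17, towards (LS):
# the LEVEL-`N` EIGEN-PROJECTOR `eN_N : E[p^N] → E[p^N]` of a CM summand, the induced splitting of `H¹(·, E[p^N])`, and the ISOTROPY of the
# cyclic `E[𝔮^∞][p^N]` under the (alternating) Weil pairing — the cup product of two `ẽ_N`-classes VANISHES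

Cell `bsd-print-cf2`, EXTRA WIDTH seat `bsd-line-cf2-p1-w4` g9 (prover-bsd-line-cf2-p1-w4-g9-0); `--supports stmt-BirchSwinnertonDyer-20368`
(helper, Theses-free). HONEST FRAMING: nothing here closes the crux or a registered stub; BSD is not proved by any of this; no summit statement
is proved by this seat. No definition (the projector is carried as an `∃`, like -w7 g2's `exists_eigenProjector`), no named fact, no `sorry`.

WHY (TURNKEY-20368-LS-w4g9.md §2). After p668156 the (R-TOP) residual of LEAD g12's p664178 is (LS), the level-`K` local surjectivity for
`W* = E[𝔮_r^∞]`, to be proved by porting X11b's `levelLiftingP_of_finite` (JSW17 Prop. 3.3.2) to `W*`-FAMILIES at `E[2^N]`-level. The one new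
ingredient of that port is the vanishing of the Poitou–Tate local terms `⟨ι s_w ∪_ε ỹ⟩` on the `W*`-component of `ỹ`: it needs (a) a `Γ`-equivariant
idempotent `ẽ_N` of `E[p^N]` cutting out `W*[p^N]` AT FINITE LEVEL (§1, from any equivariant projector `e : E[p^∞] → W*` with `e ∘ ι = id`),
(b) the splitting `a = H¹(eN_N) a + H¹(eN′_N) a` over every `F`-field (§2), and (c) **`H¹(eN_N) a ∪_ε H¹(eN_N) b = 0`** (§3): `W*[p^N]` is CYCLIC for the
class (-w2 g7 `CMPrimes.endEigenPrimaryTorsion_two_structure`) and the Weil pairing is ALTERNATING and biadditive, so it is identically `1` on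
`W*[p^N] × W*[p^N]`; then the cup-product 2-cocycle `(σ, τ) ↦ ⟨eN f σ, σ eN g τ⟩` vanishes identically.
presearch: Milne ADT I §6 proof of Prop. 6.9 / JSW17 Prop. 3.3.2 (isotropy of Kummer images — here of a cyclic eigen-line); no new fact. beyond-print
theorem: no.

References: [JetchevSkinnerWan2017] Prop. 3.3.2; [MilneADT2006] I §6; [SilvermanAEC2009] Prop. III.8.1 (a)–(d); [Rubin1999] §2;
[NeukirchSchmidtWingberg2008] I §4 (1.4.2).
-/

noncomputable section

open scoped Classical

set_option linter.dupNamespace false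
set_option autoImplicit false

open CategoryTheory Field
open Literature.NumberTheory.EllipticCurves
open Literature.NumberTheory.GaloisRepresentations
open Literature.NumberTheory.GaloisRepresentations.DiscreteGaloisModule
open Literature.NumberTheory.GaloisCohomology
open scoped ContRepresentation
open Summit.BirchSwinnertonDyer.Rank1Residual.X11b

universe u

namespace Summit.BirchSwinnertonDyer.BirchSwinnertonDyer.Theorems.PrintCf2.LevelEigen

/-! ## §1. The level-`N` eigen-projector `ẽ_N` (existence with its properties; no definition) -/

section Projector

variable {F : Type u} [Field F] (V : WeierstrassCurve F) (p : ℕ) [Fact p.Prime] (π : V.endRing) (r : ℤ_[p]) (N : ℕ)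

/-- **The level-`N` eigen-projector.** Given a `Γ_F`-equivariant additive `e : E[p^∞] → E[𝔮^∞]` with `e ∘ ι = id`, there is a continuous
`Γ_F`-intertwining endomorphism `ẽ_N` of the discrete Galois module `E[p^N]` whose underlying point is `ι (e (x))` (`x ∈ E[p^N] ⊆ E[p^∞]`), which
is the identity on `E[𝔮^∞] ∩ E[p^N]`, kills every `x` killed by `e`, has values in `E[𝔮^∞]`, and is idempotent. [cite: Rubin1999, §2]
[cite: SerreGaloisCohomology1997, I §2.4] -/
theorem exists_levelProj (e : V.geomPrimaryTorsion p →+ ↥(V.endEigenPrimaryTorsion p π r))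
    (he₁ : ∀ x : ↥(V.endEigenPrimaryTorsion p π r), e x = x)
    (he : ∀ (σ : absoluteGaloisGroup F) (x : V.geomPrimaryTorsion p), e (σ • x) = σ • e x) :
    ∃ eN : (V.torsionGaloisModule ((p ^ N : ℕ) : ℤ)).toContRepresentation →ⁱL
        (V.torsionGaloisModule ((p ^ N : ℕ) : ℤ)).toContRepresentation,
      (∀ x, ((eN x : V.geomTorsion ((p ^ N : ℕ) : ℤ)) : V.geomPoints) =
        ((e (Levels.primaryInclusion V p N x) : ↥(V.endEigenPrimaryTorsion p π r)) : V.geomPrimaryTorsion p)) ∧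
      (∀ x, Levels.primaryInclusion V p N (eN x) = (e (Levels.primaryInclusion V p N x) : V.geomPrimaryTorsion p)) ∧
      (∀ x, Levels.primaryInclusion V p N x ∈ V.endEigenPrimaryTorsion p π r → eN x = x) ∧
      (∀ x, e (Levels.primaryInclusion V p N x) = 0 → eN x = 0) ∧
      (∀ x, Levels.primaryInclusion V p N (eN x) ∈ V.endEigenPrimaryTorsion p π r) ∧
      (∀ x, eN (eN x) = eN x) := by
  -- the underlying additive map
  have hmem : ∀ x : V.geomTorsion ((p ^ N : ℕ) : ℤ),
      (((e (Levels.primaryInclusion V p N x) : ↥(V.endEigenPrimaryTorsion p π r)) : V.geomPrimaryTorsion p) : V.geomPoints) ∈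
        V.geomTorsion ((p ^ N : ℕ) : ℤ) := by
    intro x
    rw [WeierstrassCurve.mem_geomTorsion_iff, natCast_zsmul]
    have h0 : p ^ N • e (Levels.primaryInclusion V p N x) = 0 := by
      rw [← map_nsmul, ← map_nsmul, Levels.pow_nsmul_geomTorsion_eq_zero, map_zero, map_zero]
    have h1 := congrArg (fun y : ↥(V.endEigenPrimaryTorsion p π r) ↦ ((y : V.geomPrimaryTorsion p) : V.geomPoints)) h0
    simpa only [AddSubgroupClass.coe_nsmul, ZeroMemClass.coe_zero] using h1
  let f : V.geomTorsion ((p ^ N : ℕ) : ℤ) →+ V.geomTorsion ((p ^ N : ℕ) : ℤ) :=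
    { toFun := fun x ↦ ⟨_, hmem x⟩
      map_zero' := Subtype.ext (by simp only [map_zero, ZeroMemClass.coe_zero])
      map_add' := fun x y ↦ Subtype.ext (by simp only [map_add, AddMemClass.coe_add]) }
  have hf : ∀ x, ((f x : V.geomTorsion ((p ^ N : ℕ) : ℤ)) : V.geomPoints) =
      ((e (Levels.primaryInclusion V p N x) : ↥(V.endEigenPrimaryTorsion p π r)) : V.geomPrimaryTorsion p) := fun _ ↦ rfl
  have hfsmul : ∀ (σ : absoluteGaloisGroup F) (x : V.geomTorsion ((p ^ N : ℕ) : ℤ)), f (σ • x) = σ • f x := by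
    intro σ x
    apply Subtype.ext
    rw [hf]
    have hι : Levels.primaryInclusion V p N (σ • x) = σ • Levels.primaryInclusion V p N x := Subtype.ext rfl
    rw [hι, he, WeierstrassCurve.endEigenPrimaryTorsion.coe_smul, primaryComponent.coe_smul, ← hf x]
    rfl
  refine ⟨⟨⟨f.toIntLinearMap, continuous_of_discreteTopology⟩, fun σ ↦ ?_⟩, fun x ↦ rfl, fun x ↦ ?_, fun x hx ↦ ?_, fun x hx ↦ ?_,
    fun x ↦ ?_, fun x ↦ ?_⟩
  · ext x
    exact congrArg Subtype.val (hfsmul σ x)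
  · exact Subtype.ext rfl
  · -- identity on the summand
    apply Subtype.ext
    change ((f x : V.geomTorsion ((p ^ N : ℕ) : ℤ)) : V.geomPoints) = x
    rw [hf, he₁ ⟨_, hx⟩]
    rfl
  · apply Subtype.ext
    change ((f x : V.geomTorsion ((p ^ N : ℕ) : ℤ)) : V.geomPoints) = ((0 : V.geomTorsion ((p ^ N : ℕ) : ℤ)) : V.geomPoints)
    rw [hf, hx]
    rfl
  · change Levels.primaryInclusion V p N (f x) ∈ V.endEigenPrimaryTorsion p π r
    have h : Levels.primaryInclusion V p N (f x) = (e (Levels.primaryInclusion V p N x) : V.geomPrimaryTorsion p) := Subtype.ext rfl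
    rw [h]
    exact (e _).2
  · -- idempotent
    change f (f x) = f x
    apply Subtype.ext
    rw [hf, hf]
    have h : Levels.primaryInclusion V p N (f x) = (e (Levels.primaryInclusion V p N x) : V.geomPrimaryTorsion p) := Subtype.ext rfl
    rw [h, he₁]

end Projector

/-! ## §2. The splitting of `H¹` at level `N` over every `F`-field -/

section Splitting

variable {F : Type u} [Field F] (V : WeierstrassCurve F) (p : ℕ) (N : ℕ) (E : Type u) [Field E] [Algebra F E]

/-- **`H¹(ẽ) a + H¹(eN′) a = a`** over any `F`-field `E` for two continuous equivariant endomorphisms of `E[p^N]` with `eN x + eN′ x = x` (on cocycles,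
`oneCocycleClass_add`). [cite: SerreGaloisCohomology1997, I §2.4] -/
theorem map_restrictField_add_map_restrictField_eq
    (eN eN' : (V.torsionGaloisModule ((p ^ N : ℕ) : ℤ)).toContRepresentation →ⁱL
      (V.torsionGaloisModule ((p ^ N : ℕ) : ℤ)).toContRepresentation)
    (hsum : ∀ x, eN x + eN' x = x)
    (a : galoisCohomology (GaloisRep.restrictField E (V.torsionGaloisModule ((p ^ N : ℕ) : ℤ))) 1) :
    galoisCohomology.map (eN.restrictField E) 1 a + galoisCohomology.map (eN'.restrictField E) 1 a = a := by
  obtain ⟨φ, rfl⟩ := oneCocycleClass_surjective _ a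
  rw [galoisCohomology.map_one_oneCocycleClass, galoisCohomology.map_one_oneCocycleClass]
  have key : oneCocycleClass (GaloisRep.restrictField E (V.torsionGaloisModule ((p ^ N : ℕ) : ℤ))).toTopRep
        (contOneCocycles.pullback (ContinuousMonoidHom.id (absoluteGaloisGroup E))
          (TopRep.ofHom ⟨(eN.restrictField E).toContinuousLinearMap, (eN.restrictField E).isIntertwining'⟩) φ) +
      oneCocycleClass (GaloisRep.restrictField E (V.torsionGaloisModule ((p ^ N : ℕ) : ℤ))).toTopRep
        (contOneCocycles.pullback (ContinuousMonoidHom.id (absoluteGaloisGroup E))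
          (TopRep.ofHom ⟨(eN'.restrictField E).toContinuousLinearMap, (eN'.restrictField E).isIntertwining'⟩) φ) =
      oneCocycleClass _ φ := by
    rw [← oneCocycleClass_add]
    congr 1
    refine Subtype.ext (ContinuousMap.ext fun σ ↦ ?_)
    exact hsum (φ.1 σ)
  exact key

end Splitting

/-! ## §3. Isotropy: the cup product of two `ẽ_N`-classes vanishes -/

section Isotropy

variable {F : Type u} [Field F] [CharZero F] (V : WeierstrassCurve F) [V.IsElliptic] (n : ℕ) [NeZero n]
  (ε : V.geomTorsion n → V.geomTorsion n → AlgebraicClosure F)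
  (hμ : ∀ S T, ε S T ^ n = 1)
  (hadd₁ : ∀ S₁ S₂ T, ε (S₁ + S₂) T = ε S₁ T * ε S₂ T)
  (hadd₂ : ∀ S T₁ T₂, ε S (T₁ + T₂) = ε S T₁ * ε S T₂)
  (hgal : ∀ (σ : absoluteGaloisGroup F) (S T : V.geomTorsion n), σ • ε S T = ε (σ • S) (σ • T))

omit [CharZero F] [V.IsElliptic] in
/-- **A biadditive alternating pairing vanishes identically on a cyclic subgroup**: if `eN` has values in `ℤ·g` then
`⟨eN x, eN y⟩ = ab·⟨g, g⟩ = 0` (additively). [cite: SilvermanAEC2009, Prop. III.8.1 (a)–(c)] -/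
theorem weilPairingHom_apply_apply_eq_zero_of_cyclic (halt : ∀ T, ε T T = 1)
    (eN : (V.torsionGaloisModule n).toContRepresentation →ⁱL (V.torsionGaloisModule n).toContRepresentation)
    {g : V.geomTorsion n} (hcyc : ∀ x, ∃ a : ℤ, eN x = a • g) (x y : V.geomTorsion n) :
    weilPairingHom V n ε hμ hadd₁ hadd₂ (eN x) (eN y) = 0 := by
  obtain ⟨a, ha⟩ := hcyc x
  obtain ⟨b, hb⟩ := hcyc y
  rw [ha, hb, map_zsmul, map_zsmul, AddMonoidHom.zsmul_apply, weilPairingHom_self V n ε hμ hadd₁ hadd₂ halt, zsmul_zero, zsmul_zero]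

variable (E : Type u) [Field E] [Algebra F E]

omit [CharZero F] [V.IsElliptic] in
/-- **ISOTROPY ON `H¹`: `H¹(ẽ) a ∪_ε H¹(ẽ) b = 0`** over every `F`-field `E` (a completion), for the Weil cup product of `E[n]` restricted to `Γ_E`
and any continuous equivariant endomorphism `eN` of `E[n]` on whose image `ε` vanishes identically: the inhomogeneous 2-cocycle
`(σ, τ) ↦ ⟨eN f σ, eN g (στ) − eN g σ⟩` is zero. The vanishing of the Poitou–Tate local terms on the `W*`-component (TURNKEY-20368-LS §2(c)).
[cite: NeukirchSchmidtWingberg2008, I §4 (1.4.2)] [cite: MilneADT2006, I §6 proof of Prop. 6.9] -/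
theorem cupProduct_map_levelProj_eq_zero [LocallyCompactSpace (absoluteGaloisGroup E)]
    (eN : (V.torsionGaloisModule n).toContRepresentation →ⁱL (V.torsionGaloisModule n).toContRepresentation)
    (hiso : ∀ x y, weilPairingHom V n ε hμ hadd₁ hadd₂ (eN x) (eN y) = 0)
    (a b : galoisCohomology (GaloisRep.restrictField E (V.torsionGaloisModule n)) 1) :
    ((weilContPairing V n ε hμ hadd₁ hadd₂ hgal).restrict (absGaloisRestrict F E)).cupProduct
      (galoisCohomology.map (eN.restrictField E) 1 a) (galoisCohomology.map (eN.restrictField E) 1 b) = 0 := by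
  obtain ⟨f, rfl⟩ := oneCocycleClass_surjective _ a
  obtain ⟨g, rfl⟩ := oneCocycleClass_surjective _ b
  rw [galoisCohomology.map_one_oneCocycleClass, galoisCohomology.map_one_oneCocycleClass]
  refine (ContPairing.cupProduct_oneCocycleClass_eq_twoCocycleClass _ _ _).trans ?_
  have h0 : ((weilContPairing V n ε hμ hadd₁ hadd₂ hgal).restrict (absGaloisRestrict F E)).cupCocycle
      (contOneCocycles.pullback (ContinuousMonoidHom.id (absoluteGaloisGroup E))
        (TopRep.ofHom ⟨(eN.restrictField E).toContinuousLinearMap, (eN.restrictField E).isIntertwining'⟩) f)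
      (contOneCocycles.pullback (ContinuousMonoidHom.id (absoluteGaloisGroup E))
        (TopRep.ofHom ⟨(eN.restrictField E).toContinuousLinearMap, (eN.restrictField E).isIntertwining'⟩) g) = 0 := by
    refine Subtype.ext (ContinuousMap.ext fun στ ↦ ?_)
    obtain ⟨σ, τ⟩ := στ
    rw [ContPairing.cupCocycle_apply]
    change weilPairingHom V n ε hμ hadd₁ hadd₂ (eN (f.1 σ)) (eN (g.1 (σ * τ)) - eN (g.1 σ)) = 0
    rw [← map_sub, hiso]
  have h1 := congrArg (twoCocycleClass (TopRep.res ((absGaloisRestrict F E : absoluteGaloisGroup E →ₜ* absoluteGaloisGroup F) :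
    absoluteGaloisGroup E →* absoluteGaloisGroup F) (mu F n).toTopRep)) h0
  rw [twoCocycleClass_zero] at h1
  exact h1

end Isotropy

/-! ## §4. Road α: the cyclicity input for `W* = E[𝔮_r^∞]` at level `2^N` -/

section RoadAlpha

/-- **`ẽ_N` has values in a cyclic group for the class** (`W/ℚ`, `j = −3375`, `L ∋ θ`, `θ² = −7`, `π² = π − 2`, `r² = r − 2`): every `eN_N x` is an
integer multiple of one point `g_N ∈ E[2^N]`, because `W* ∩ E[2^∞][2^N] = ℤ·g` (-w2 g7 `CMPrimes.endEigenPrimaryTorsion_two_structure`) and `ι` is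
injective. Feeds `weilPairingHom_apply_apply_eq_zero_of_cyclic`. [cite: Rubin1999, §2 and Prop. 5.4] -/
theorem exists_forall_levelProj_eq_zsmul (W : WeierstrassCurve ℚ) [W.IsElliptic] (hj : W.j = -3375)
    (L : Type) [Field L] [NumberField L] {θ : L} (hθ : θ ^ 2 = -7) (π : (W.baseChange L).endRing)
    (hrel : (π : AddMonoid.End (W.baseChange L).geomPoints) * π = π - 2) {r : ℤ_[2]} (hr : r * r = r - 2) (N : ℕ)
    (eN : ((W.baseChange L).torsionGaloisModule ((2 ^ N : ℕ) : ℤ)).toContRepresentation →ⁱL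
      ((W.baseChange L).torsionGaloisModule ((2 ^ N : ℕ) : ℤ)).toContRepresentation)
    (heN : ∀ x, Levels.primaryInclusion (W.baseChange L) 2 N (eN x) ∈ (W.baseChange L).endEigenPrimaryTorsion 2 π r) :
    ∃ g : (W.baseChange L).geomTorsion ((2 ^ N : ℕ) : ℤ), ∀ x, ∃ a : ℤ, eN x = a • g := by
  haveI : Fact (Nat.Prime 2) := ⟨Nat.prime_two⟩
  obtain ⟨-, -, -, -, -, -, hgen, -⟩ := CMPrimes.endEigenPrimaryTorsion_two_structure W hj L hθ π hrel hr
  obtain ⟨g, -, -, hzm⟩ := hgen N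
  -- `g ∈ E[2^∞][2^N]` comes from level `N`
  have hg2 : 2 ^ N • g = 0 := by
    have : g ∈ (W.baseChange L).endEigenPrimaryTorsion 2 π r ⊓ AddSubgroup.torsionBy ((W.baseChange L).geomPrimaryTorsion 2) (2 ^ N : ℕ) := by
      rw [hzm]; exact AddSubgroup.mem_zmultiples g
    have h2 := (Submodule.mem_torsionBy_iff (R := ℤ) _ _).mp (AddSubgroup.mem_inf.mp this).2
    rwa [natCast_zsmul] at h2
  obtain ⟨g₀, hg₀⟩ := Levels.exists_primaryInclusion_eq_of_nsmul_eq_zero (W.baseChange L) 2 N g hg2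
  refine ⟨g₀, fun x ↦ ?_⟩
  have hmem : Levels.primaryInclusion (W.baseChange L) 2 N (eN x) ∈
      (W.baseChange L).endEigenPrimaryTorsion 2 π r ⊓ AddSubgroup.torsionBy ((W.baseChange L).geomPrimaryTorsion 2) (2 ^ N : ℕ) :=
    AddSubgroup.mem_inf.mpr ⟨heN x, (Submodule.mem_torsionBy_iff (R := ℤ) _ _).mpr (by
      rw [natCast_zsmul, ← map_nsmul, Levels.pow_nsmul_geomTorsion_eq_zero, map_zero])⟩
  rw [hzm, AddSubgroup.mem_zmultiples_iff] at hmem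
  obtain ⟨a, ha⟩ := hmem
  refine ⟨a, Levels.primaryInclusion_injective (W.baseChange L) 2 N ?_⟩
  rw [map_zsmul, hg₀, ha]

end RoadAlpha

end Summit.BirchSwinnertonDyer.BirchSwinnertonDyer.Theorems.PrintCf2.LevelEigen

end
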